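import Summits.CriticalPhenomena.PercolationContinuityZ3.Theorems.PercNearOneGluingNoHeavyConstsClusterSquareApexLinked
import HarnessLib

/-!
# CSQ, DUU and TS on an outerplanar graph plus one APEX inside a face (terminals on the rim)

builds on p205010 (kernel theorem, internal audit signed; external expert review pending)

PAPER-2 track "percolation constants", part (ii), seat `prim-consts-1`, gen 20 (lane index
`run/shared/lean/prim/consts/CONSTANTS.md`, row A19; memo `FROM-prim-consts-1-g20-APEX-FACE.md`).
Support file for the crux `NoHeavyLowerTail` (stmt-CriticalPhenomena-4575; `--supports`).  Theorems only; no definitions, no sorries.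

THE CLASS.  `H` on `Fin n` with a distinguished vertex `h` (the APEX or hub); every other vertex is a RIM vertex with a position
`pos u : Fin m`, `pos` injective on the rim.  Hypotheses: (R) the rim edges are pairwise NON-CROSSING for the cyclic order of the
positions (no rim edges `{p,q}`, `{r,s}` with `pos p < pos r < pos q < pos s`) — the rim graph is outerplanar with the rim vertices
in this cyclic order on the outer face; (F) no rim edge SEPARATES two neighbours of the apex (no rim edge `{p,q}` and apex-neighbours
`u, v` with `u` strictly between `p` and `q` and `v` outside) — the apex is drawn inside ONE face of the outerplanar rim graph.
These graphs are planar with every rim vertex on the outer face; they contain all partial wheels (`…ClusterSquareWheel`, where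
rim edges join consecutive positions only, so (R), (F) are void), every fan, every triangulated or chorded polygon with one
interior vertex joined into one of its faces, and every outerplanar graph (apex isolated).  THE RESULT: for terminals
`a, b, c` on the rim no cluster of `a` is doubly linked to `{b, c}` (`Consts.Apex.unlinked`), hence CSQ, DUU and TS for every
weight vector supported on `H` (`Consts.clusterSquare_le_sq_of_apex`, `Consts.sq_real_split_le_of_apex`, `Consts.tripleSplit_of_apex`;
concrete `Fin (N+1)` form `Consts.tripleSplit_apex`).  Structural census (lane engines g19 `eng/apexface.py`: 1 110/1 110 rooted
cases NDC; g20 `eng/apex_unlinked.py` + kit job: the combinatorial statement below checked exhaustively on all (R)+(F) graphs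
with ≤ 6 rim vertices, 0 violations, while dropping (R) or (F) produces violations).

THE PROOF (memo g19 §3(iii), simplified; the two endgames are in `…ConstsClusterSquareApexLinked.lean`).  With the master gap
lemma `Consts.Apex.cnt_eq_of_walk` the outerplanar endgame of `Consts.NonCrossing.unlinked` goes through verbatim when both clash
vertices are rim vertices (`Consts.Apex.false_of_linked_rim`); when one of them is the apex, `Consts.Apex.false_of_linked_hub`
produces a rim edge separating two apex-neighbours, contradicting (F).  Here the two auxiliary graphs are instantiated (`G₀` = rim
edges of `H`, `H'` = rim edges plus a chord for every two rim neighbours of the apex) and (R)+(F) are shown to say exactly that no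
`H'`-edge crosses a `G₀`-edge.
References: N. Gladkov, arXiv:2408.08457v2 (2024), Thm. 4.3, Def. 4.2, Lemma 3.1, Thm. 5.2 (two-copy vdBK behind
`…ClusterSquareUnlinked`); G. Chartrand, F. Harary, Ann. Inst. H. Poincaré B 3 (1967) 433–438 (outerplanar graphs).
-/

noncomputable section

open Classical

namespace Summit.CriticalPhenomena.PercolationContinuityZ3.Theorems

open MeasureTheory Finset Literature.Probability.LatticeModels Literature.Probability.Percolation

namespace Consts

namespace Apex

variable {n m : ℕ}

/-! ### No double linkage: apex inside a face -/

/-- **No `H`-connected `K ∋ a` is doubly linked to `{b, c}` when `H` is an outerplanar rim graph plus one apex inside a face**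
(hypotheses (R), (F) of the module docstring; `a, b, c` on the rim): the hypothesis `hK` of `Consts.clusterSquare_le_sq_of_unlinked`
holds. [folklore: Jordan curve theorem; cf. the planar common-face theorem of Gladkov2024, Thm. 6.1 (connection side, constant 2)] -/
theorem unlinked (H : SimpleGraph (Fin n)) (h : Fin n) (pos : Fin n → Fin m)
    (hpos : ∀ u v, u ≠ h → v ≠ h → pos u = pos v → u = v)
    (hR : ∀ p q r s : Fin n, p ≠ h → q ≠ h → r ≠ h → s ≠ h → H.Adj p q → H.Adj r s →
      pos p < pos r → pos r < pos q → pos q < pos s → False)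
    (hF : ∀ p q u v : Fin n, p ≠ h → q ≠ h → H.Adj p q → H.Adj h u → H.Adj h v →
      pos p < pos u → pos u < pos q → (pos q < pos v ∨ pos v < pos p) → False)
    {a b c : Fin n} (ha : a ≠ h) (hb : b ≠ h) (hc : c ≠ h) :
    ∀ (K : Set (Fin n)) (y y' : Fin n), a ∈ K → b ∉ K → c ∉ K →
      (∀ T : Set (Fin n), a ∈ T → (∀ u x, u ∈ T → H.Adj u x → x ∈ K → x ∈ T) → K ⊆ T) →
      y ∉ K → y' ∉ K → (∃ k, k ∈ K ∧ H.Adj k y) → (∃ k, k ∈ K ∧ H.Adj k y') →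
      y ≠ a → y ≠ b → y ≠ c → y' ≠ a → y' ≠ b → y' ≠ c → y ≠ y' →
      (∀ (P₁ : H.Walk y b) (P₂ : H.Walk y' c), (∀ x ∈ P₁.support, x ∉ K) → (∀ x ∈ P₂.support, x ∉ K) →
          ∃ x, x ∈ P₁.support ∧ x ∈ P₂.support) ∨
      (∀ (Q₁ : H.Walk y c) (Q₂ : H.Walk y' b), (∀ x ∈ Q₁.support, x ∉ K) → (∀ x ∈ Q₂.support, x ∉ K) →
          ∃ x, x ∈ Q₁.support ∧ x ∈ Q₂.support) := by
  intro K y y' haK hbK hcK hcl hyK hy'K hky hk'y' _ hyb hyc _ hy'b hy'c hyy'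
  -- the rim graph `G₀` and the hub-contracted graph `H'`
  let G₀ : SimpleGraph (Fin n) := SimpleGraph.fromRel fun u v => H.Adj u v ∧ u ≠ h ∧ v ≠ h
  let H' : SimpleGraph (Fin n) := SimpleGraph.fromRel fun u v => u ≠ h ∧ v ≠ h ∧ (H.Adj u v ∨ (H.Adj h u ∧ H.Adj h v))
  have hG₀ : ∀ u v, G₀.Adj u v → H.Adj u v ∧ u ≠ h ∧ v ≠ h := by
    intro u v huv
    rcases (SimpleGraph.fromRel_adj _ u v).1 huv with ⟨_, ⟨e, hu, hv⟩ | ⟨e, hv, hu⟩⟩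
    · exact ⟨e, hu, hv⟩
    · exact ⟨e.symm, hu, hv⟩
  have hH' : ∀ u v, H'.Adj u v → u ≠ h ∧ v ≠ h ∧ (H.Adj u v ∨ (H.Adj h u ∧ H.Adj h v)) := by
    intro u v huv
    rcases (SimpleGraph.fromRel_adj _ u v).1 huv with ⟨_, ⟨hu, hv, e⟩ | ⟨hv, hu, e⟩⟩
    · exact ⟨hu, hv, e⟩
    · rcases e with e | ⟨e1, e2⟩
      · exact ⟨hu, hv, Or.inl e.symm⟩
      · exact ⟨hu, hv, Or.inr ⟨e2, e1⟩⟩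
  have g1 : ∀ u v, H.Adj u v → u ≠ h → v ≠ h → G₀.Adj u v := fun u v e hu hv =>
    (SimpleGraph.fromRel_adj _ u v).2 ⟨e.ne, Or.inl ⟨e, hu, hv⟩⟩
  have g2 : ∀ u v, H.Adj u v → u ≠ h → v ≠ h → H'.Adj u v := fun u v e hu hv =>
    (SimpleGraph.fromRel_adj _ u v).2 ⟨e.ne, Or.inl ⟨hu, hv, Or.inl e⟩⟩
  have g3 : ∀ u v, u ≠ v → u ≠ h → v ≠ h → H.Adj h u → H.Adj h v → H'.Adj u v := fun u v huv hu hv e1 e2 =>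
    (SimpleGraph.fromRel_adj _ u v).2 ⟨huv, Or.inl ⟨hu, hv, Or.inr ⟨e1, e2⟩⟩⟩
  -- no `H'`-edge crosses a `G₀`-edge (this is (R) + (F)), in both orders, then cut open at `a`
  have h12 : ∀ p q r s : Fin n, H'.Adj p q → G₀.Adj r s → pos p < pos r → pos r < pos q → pos q < pos s → False := by
    intro p q r s hpq hrs l1 l2 l3
    obtain ⟨hp, hq, e⟩ := hH' p q hpq
    obtain ⟨ers, hr, hs⟩ := hG₀ r s hrs
    rcases e with e | ⟨e1, e2⟩
    · exact hR p q r s hp hq hr hs e ers l1 l2 l3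
    · exact hF r s q p hr hs ers e2 e1 l2 l3 (Or.inr l1)
  have h21 : ∀ p q r s : Fin n, G₀.Adj p q → H'.Adj r s → pos p < pos r → pos r < pos q → pos q < pos s → False := by
    intro p q r s hpq hrs l1 l2 l3
    obtain ⟨epq, hp, hq⟩ := hG₀ p q hpq
    obtain ⟨hr, hs, e⟩ := hH' r s hrs
    rcases e with e | ⟨e1, e2⟩
    · exact hR p q r s hp hq hr hs epq e l1 l2 l3
    · exact hF p q r s hp hq epq e1 e2 l1 l2 (Or.inl l3)
  have x1 : ∀ p q r s : Fin n, H'.Adj p q → G₀.Adj r s → (pos p - pos a).val < (pos r - pos a).val →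
      (pos r - pos a).val < (pos q - pos a).val → (pos q - pos a).val < (pos s - pos a).val → False :=
    fun p q r s hpq hrs => noncross_rot₂ h12 h21 a hpq hrs
  have x2 : ∀ p q r s : Fin n, G₀.Adj p q → H'.Adj r s → (pos p - pos a).val < (pos r - pos a).val →
      (pos r - pos a).val < (pos q - pos a).val → (pos q - pos a).val < (pos s - pos a).val → False :=
    fun p q r s hpq hrs => noncross_rot₂ h21 h12 a hpq hrs
  obtain ⟨k, hkK, hky⟩ := hky
  obtain ⟨k', hk'K, hk'y'⟩ := hk'y'
  by_contra hcon
  push Not at hcon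
  obtain ⟨⟨P₁, P₂, hP₁, hP₂, hPd⟩, ⟨Q₁, Q₂, hQ₁, hQ₂, hQd⟩⟩ := hcon
  have hKw := NonCrossing.walks_of_closure haK hcl
  have hbc : b ≠ c := fun e => hPd b P₁.end_mem_support (e ▸ P₂.end_mem_support)
  by_cases hyh : y = h
  · subst hyh
    have hy'h : y' ≠ y := fun e => hyy' e.symm
    exact false_of_linked_hub hpos g1 g2 g3 x1 x2 ha hKw hyK hb hc hy'h hkK hky hk'K hk'y' hy'b hy'c hbc
      P₁ P₂ hP₁ hP₂ hPd Q₁ Q₂ hQ₁ hQ₂ hQd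
  by_cases hy'h : y' = h
  · subst hy'h
    exact false_of_linked_hub hpos g1 g2 g3 x1 x2 ha hKw hy'K hc hb hyh hk'K hk'y' hkK hky hyc hyb hbc.symm
      P₂ P₁ hP₂ hP₁ (fun x hx hx' => hPd x hx' hx) Q₂ Q₁ hQ₂ hQ₁ (fun x hx hx' => hQd x hx' hx)
  exact false_of_linked_rim hpos g1 g2 g3 x1 x2 ha hKw hb hc hyh hy'h hkK hky hk'K hk'y' hyb hyc hy'b hy'c hyy' hbc
    P₁ P₂ hP₁ hP₂ hPd Q₁ Q₂ hQ₁ hQ₂ hQd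

end Apex

/-! ### CSQ, DUU, TS for an outerplanar graph plus an apex inside a face -/

section Fin

variable {n m : ℕ} (w : Sym2 (Fin n) → unitInterval) (a b c : Fin n) (H : SimpleGraph (Fin n)) (h : Fin n)
  (pos : Fin n → Fin m)

/-- **CSQ for an outerplanar rim graph plus one apex inside a face, terminals on the rim**: `H ⊇` positive pairs of `w`, `h` the
apex, `pos` injective on the rim, (R) rim edges non-crossing, (F) no rim edge separates two apex-neighbours; `a, b, c ≠ h`.  Then
`clusterSquare w a b c ≤ μ(b ↮ c)²`. [cite: Gladkov2024, Thm. 4.3, Def. 4.2, Lemma 3.1, Thm. 5.2] -/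
theorem clusterSquare_le_sq_of_apex (hH : ∀ u v, u ≠ v → (0 : ℝ) < w s(u, v) → H.Adj u v)
    (hpos : ∀ u v, u ≠ h → v ≠ h → pos u = pos v → u = v)
    (hR : ∀ p q r s : Fin n, p ≠ h → q ≠ h → r ≠ h → s ≠ h → H.Adj p q → H.Adj r s →
      pos p < pos r → pos r < pos q → pos q < pos s → False)
    (hF : ∀ p q u v : Fin n, p ≠ h → q ≠ h → H.Adj p q → H.Adj h u → H.Adj h v →
      pos p < pos u → pos u < pos q → (pos q < pos v ∨ pos v < pos p) → False)
    (ha : a ≠ h) (hb : b ≠ h) (hc : c ≠ h) :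
    clusterSquare w a b c ≤ (prodBernoulli w).real (openConn b c)ᶜ ^ 2 :=
  clusterSquare_le_sq_of_unlinked w a b c H hH (Apex.unlinked H h pos hpos hR hF ha hb hc)

/-- **DUU (rooted split inequality) for an outerplanar rim graph plus one apex inside a face, terminals on the rim**:
`μ(a↮b, a↮c, b↮c)² ≤ μ(a↮b, a↮c) · μ(b↮c)²`. [cite: Gladkov2024, Thm. 5.2 and Thm. 4.3] -/
theorem sq_real_split_le_of_apex (hH : ∀ u v, u ≠ v → (0 : ℝ) < w s(u, v) → H.Adj u v)
    (hpos : ∀ u v, u ≠ h → v ≠ h → pos u = pos v → u = v)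
    (hR : ∀ p q r s : Fin n, p ≠ h → q ≠ h → r ≠ h → s ≠ h → H.Adj p q → H.Adj r s →
      pos p < pos r → pos r < pos q → pos q < pos s → False)
    (hF : ∀ p q u v : Fin n, p ≠ h → q ≠ h → H.Adj p q → H.Adj h u → H.Adj h v →
      pos p < pos u → pos u < pos q → (pos q < pos v ∨ pos v < pos p) → False)
    (ha : a ≠ h) (hb : b ≠ h) (hc : c ≠ h) :
    (prodBernoulli w).real ((openConn a b)ᶜ ∩ (openConn a c)ᶜ ∩ (openConn b c)ᶜ) ^ 2 ≤
      (prodBernoulli w).real ((openConn a b)ᶜ ∩ (openConn a c)ᶜ) * (prodBernoulli w).real (openConn b c)ᶜ ^ 2 :=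
  sq_real_split_le_of_unlinked w a b c H hH (Apex.unlinked H h pos hpos hR hF ha hb hc)

/-- **TS (triple-split inequality) for an outerplanar rim graph plus one apex inside a face, terminals on the rim**:
`μ(a↮b, a↮c, b↮c)² ≤ μ(a↮b) · μ(a↮c) · μ(b↮c)`. [cite: Gladkov2024, Thm. 5.2, Cor. 5.3 (pattern) and Thm. 4.3] -/
theorem tripleSplit_of_apex (hH : ∀ u v, u ≠ v → (0 : ℝ) < w s(u, v) → H.Adj u v)
    (hpos : ∀ u v, u ≠ h → v ≠ h → pos u = pos v → u = v)
    (hR : ∀ p q r s : Fin n, p ≠ h → q ≠ h → r ≠ h → s ≠ h → H.Adj p q → H.Adj r s →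
      pos p < pos r → pos r < pos q → pos q < pos s → False)
    (hF : ∀ p q u v : Fin n, p ≠ h → q ≠ h → H.Adj p q → H.Adj h u → H.Adj h v →
      pos p < pos u → pos u < pos q → (pos q < pos v ∨ pos v < pos p) → False)
    (ha : a ≠ h) (hb : b ≠ h) (hc : c ≠ h) :
    (prodBernoulli w).real ((openConn a b)ᶜ ∩ (openConn a c)ᶜ ∩ (openConn b c)ᶜ) ^ 2 ≤
      (prodBernoulli w).real (openConn a b)ᶜ * (prodBernoulli w).real (openConn a c)ᶜ *
        (prodBernoulli w).real (openConn b c)ᶜ :=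
  tripleSplit_of_unlinked w a b c H hH (Apex.unlinked H h pos hpos hR hF ha hb hc)

end Fin

/-! ### Concrete form: vertices `Fin (N+1)`, apex `Fin.last N`, rim `i.castSucc` in the natural cyclic order -/

/-- **TS for the weighted "polygon with chords plus one interior vertex" graphs on `Fin (N+1)`**: apex `Fin.last N`, rim vertices
`i.castSucc` (`i : Fin N`) in their natural cyclic order; `w` any weight vector whose positive rim–rim pairs are non-crossing chords
(`hR`) none of which separates two rim vertices positively joined to the apex (`hF`).  Then for all rim terminals `a, b, c`:
`μ(a↮b, a↮c, b↮c)² ≤ μ(a↮b) μ(a↮c) μ(b↮c)` — all weighted wheels, fans, chorded polygons with an interior vertex inside one face.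
[cite: Gladkov2024, Thm. 5.2, Cor. 5.3 (pattern) and Thm. 4.3] -/
theorem tripleSplit_apex (N : ℕ) (w : Sym2 (Fin (N + 1)) → unitInterval)
    (hR : ∀ p q r s : Fin N, (0 : ℝ) < w s(p.castSucc, q.castSucc) → (0 : ℝ) < w s(r.castSucc, s.castSucc) →
      p < r → r < q → q < s → False)
    (hF : ∀ p q u v : Fin N, (0 : ℝ) < w s(p.castSucc, q.castSucc) → (0 : ℝ) < w s(Fin.last N, u.castSucc) →
      (0 : ℝ) < w s(Fin.last N, v.castSucc) → p < u → u < q → (q < v ∨ v < p) → False)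
    (a b c : Fin N) :
    (prodBernoulli w).real ((openConn a.castSucc b.castSucc)ᶜ ∩ (openConn a.castSucc c.castSucc)ᶜ ∩
        (openConn b.castSucc c.castSucc)ᶜ) ^ 2 ≤
      (prodBernoulli w).real (openConn a.castSucc b.castSucc)ᶜ * (prodBernoulli w).real (openConn a.castSucc c.castSucc)ᶜ *
        (prodBernoulli w).real (openConn b.castSucc c.castSucc)ᶜ := by
  -- support graph: all positive pairs; positions: the identity of `Fin (N+1)` (the apex gets position `N`, never used)
  let H : SimpleGraph (Fin (N + 1)) := SimpleGraph.fromRel fun u v => (0 : ℝ) < w s(u, v)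
  have hH : ∀ u v, u ≠ v → (0 : ℝ) < w s(u, v) → H.Adj u v := fun u v huv hw =>
    (SimpleGraph.fromRel_adj _ u v).2 ⟨huv, Or.inl hw⟩
  have hH' : ∀ u v, H.Adj u v → (0 : ℝ) < w s(u, v) := by
    intro u v huv
    rcases (SimpleGraph.fromRel_adj _ u v).1 huv with ⟨_, e | e⟩
    · exact e
    · rwa [Sym2.eq_swap] at e
  -- every non-apex vertex is a `castSucc`
  have hcast : ∀ u : Fin (N + 1), u ≠ Fin.last N → ∃ i : Fin N, u = i.castSucc := fun u hu =>
    ⟨u.castPred hu, (Fin.castSucc_castPred u hu).symm⟩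
  let pos : Fin (N + 1) → Fin (N + 1) := id
  refine tripleSplit_of_apex w a.castSucc b.castSucc c.castSucc H (Fin.last N) pos hH (fun u v _ _ e => e)
    ?_ ?_ (Fin.castSucc_lt_last a).ne (Fin.castSucc_lt_last b).ne (Fin.castSucc_lt_last c).ne
  · intro p q r s hp hq hr hs hpq hrs l1 l2 l3
    obtain ⟨p, rfl⟩ := hcast p hp; obtain ⟨q, rfl⟩ := hcast q hq
    obtain ⟨r, rfl⟩ := hcast r hr; obtain ⟨s, rfl⟩ := hcast s hs
    exact hR p q r s (hH' _ _ hpq) (hH' _ _ hrs) (Fin.castSucc_lt_castSucc_iff.1 l1)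
      (Fin.castSucc_lt_castSucc_iff.1 l2) (Fin.castSucc_lt_castSucc_iff.1 l3)
  · intro p q u v hp hq hpq hu hv l1 l2 l3
    obtain ⟨p, rfl⟩ := hcast p hp; obtain ⟨q, rfl⟩ := hcast q hq
    obtain ⟨u, rfl⟩ := hcast u (hu.ne).symm; obtain ⟨v, rfl⟩ := hcast v (hv.ne).symm
    refine hF p q u v (hH' _ _ hpq) (hH' _ _ hu) (hH' _ _ hv) (Fin.castSucc_lt_castSucc_iff.1 l1)
      (Fin.castSucc_lt_castSucc_iff.1 l2) ?_
    rcases l3 with l3 | l3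
    · exact Or.inl (Fin.castSucc_lt_castSucc_iff.1 l3)
    · exact Or.inr (Fin.castSucc_lt_castSucc_iff.1 l3)

end Consts

end Summit.CriticalPhenomena.PercolationContinuityZ3.Theorems
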